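import Literature.AlgebraicGeometry.Motives.AbelianVarietyTateModuleAlong
import Literature.NumberTheory.DiophantineGeometry.AVIsogenyTateHomProofs
import HarnessLib

/-!
# Transfer of «`u` is the identity» and «`u` fixes the `N`-torsion» along a base change of the ground field
# ([MumfordAV1970] §4, §6 App. 3 (`A[n](k̄)` has `n^{2g}` points); [SerreTate1968] §1; [Hartshorne1977] II Ex. 2.7)

Cell `hodgecm-mathlib` (D-0151), F-DAG (L3) F4 «rigidity with level structure over any field» plumbing (D5)+(D6)+(D7)
(cut-owner B-p03 (g17) 06:56:36Z; sockets B-p11 (g16) `SOCKETS-L3-AutBaseChangeTransfer` T1–T5; author B-p13 (g19)).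
PROOF lane, theorems only (no definition, no named fact, no instance, no `sorry`).

For an abelian variety `B` over a field `k`, a field extension `L/k` (`[Algebra k L]`), the base change `B ⊗_k L`
(★ `AbelianVariety.baseChange`) and a homomorphism `u : B → B` with base change `u ⊗ L` (★ `Hom.baseChange`):

* §1 (D6) FAITHFULNESS — `eq_id_of_baseChange_eq_id`: `u ⊗ L = 𝟙 ⇒ u = 𝟙` (★ `Hom.baseChange_injective` = ★
  `eq_of_baseChange_eq`, fpqc descent of morphisms along `Spec L → Spec k`);
* §2 (D5, DOWN) — `forall_torsion_map_eq_of_baseChange`: if `u ⊗ L` fixes every `N`-torsion `L`-point of `B ⊗ L` then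
  `u` fixes every `N`-torsion `k`-point of `B` (read a `k`-point `Q` as the `L`-point `(Q_L)` through ★ `pointsMulEquiv` ∘
  ★ `AlgPoints.extendScalars`, injective; naturality ★ `pointsMulEquiv_map`);
* §3 (D5, UP) — `exists_pointsMulEquiv_extendScalars_eq_of_mem_torsionPoints` (for `k` AND `L` algebraically closed and
  `N` invertible in `k`, every `N`-torsion `L`-point of `B ⊗ L` is `(Q_L)` for an `N`-torsion `k`-point `Q`: both torsion
  groups have `N^{2 dim B}` elements, ★ `natCard_torsionPoints_eq_of_isAlgClosed`, and `Q ↦ Q_L` is injective — the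
  count argument of ★ `AbelianVarietyIsogenyModelDescent` with `ℂ` replaced by any algebraically closed `L`), hence
  `forall_torsion_map_baseChange_eq`: if `u` fixes `B[N](k)` then `u ⊗ L` fixes `(B ⊗ L)[N](L)`;
* §4 TRANSPORT along a descent isomorphism `ε : B₁ ⊗ L ≅ B` with `(e₁ ⊗ L) ≫ ε = ε ≫ e` —
  `forall_torsion_map_eq_iff_of_conj` (the torsion clause) and `baseChange_eq_id_iff_of_conj` (the conclusion);
* §5 (D7) GLUE — `eq_id_of_forall_torsion_map_eq_of_baseChange`: a rigidity statement «fixes the `N`-torsion ⇒ is the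
  identity» proved for `B ⊗ L` yields the same statement for `B` (`k`, `L` algebraically closed).

HC_CM is proved only modulo the 7 printed citations until rung 0 closes; count-neutral F-DAG capital (consumer F4).

## References
* [MumfordAV1970] D. Mumford, *Abelian Varieties* (1970), §4 (rational points under base change), §6 Application 3
  (Proposition p. 64: `#A[n](k̄) = n^{2g}` for `char k ∤ n`).
* [SerreTate1968] J.-P. Serre, J. Tate, *Good reduction of abelian varieties*, Ann. of Math. 88 (1968), §1 p. 493
  (`A_m ⊂ A(K_s)`).
* [Hartshorne1977] R. Hartshorne, *Algebraic Geometry* (1977), II Ex. 2.7 (points with values in a field), II.3 Thm. 3.3.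
-/

noncomputable section

universe u

open CategoryTheory CategoryTheory.Limits AlgebraicGeometry Function

namespace Literature.AlgebraicGeometry.Motives.AbelianVariety

open scoped MonObj

variable {k : Type u} [Field k] (L : Type u) [Field L] [Algebra k L] {B : AbelianVariety k}

/-! ## §1 (D6) Faithfulness of base change -/

/-- **(D6) `u ⊗ L = 𝟙 ⇒ u = 𝟙`** — an endomorphism whose base change is the identity is the identity.
[cite: MumfordAV1970, §4] -/
theorem eq_id_of_baseChange_eq_id (u : B ⟶ B) (h : Hom.baseChange L u = 𝟙 (B.baseChange L)) : u = 𝟙 B :=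
  Hom.baseChange_injective L (h.trans (Hom.baseChange_id L B).symm)

/-- `Iso` form of (D6): an automorphism whose base change is the identity is the identity. [cite: MumfordAV1970, §4] -/
theorem iso_hom_eq_id_of_baseChange_eq_id (e : B ≅ B) (h : Hom.baseChange L e.hom = 𝟙 (B.baseChange L)) :
    e.hom = 𝟙 B :=
  eq_id_of_baseChange_eq_id L e.hom h

/-! ## §2 (D5, down) The torsion clause descends: `u ⊗ L` fixes `(B ⊗ L)[N](L)` ⇒ `u` fixes `B[N](k)` -/

/-- **The comparison `Q ↦ Q_L : B(k) → (B ⊗ L)(L)` is an injective homomorphism, compatible with `u ↦ u ⊗ L` and with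
`N`-torsion** — packaged: existence of `φ : B(k) →* (B ⊗ L)(L)` injective with `φ (u Q) = (u ⊗ L) (φ Q)` for all
`u : B → C`… stated for endomorphisms `u : B → B`, which is what the transfer uses (★ `pointsMulEquiv`, ★
`AlgPoints.extendScalars`, ★ `pointsMulEquiv_map`). [cite: Hartshorne1977, II Ex. 2.7] [cite: MumfordAV1970, §4] -/
theorem exists_monoidHom_points_baseChange (B : AbelianVariety k) :
    ∃ φ : B.Points k →* (B.baseChange L).Points L, Injective φ ∧
      (∀ Q : B.Points k, φ Q = B.pointsMulEquiv L (AlgPoints.extendScalars B.X k L Q)) ∧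
      ∀ (u : B ⟶ B) (Q : B.Points k),
        φ (AlgPoints.map u.hom.hom.hom Q) = AlgPoints.map (Hom.baseChange L u).hom.hom.hom (φ Q) := by
  let φ : B.Points k →* (B.baseChange L).Points L :=
    (B.pointsMulEquiv L).toMonoidHom.comp (AlgPoints.extendScalarsMonoidHom B.X k L)
  have hφ : ∀ Q : B.Points k, φ Q = B.pointsMulEquiv L (AlgPoints.extendScalars B.X k L Q) := fun Q => rfl
  refine ⟨φ, fun s t hst => AlgPoints.extendScalars_injective B.X k L ((B.pointsMulEquiv L).injective hst), hφ,
    fun u Q => ?_⟩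
  rw [hφ, hφ, ← pointsMulEquiv_map]
  rfl

/-- **(D5, DOWN) If `u ⊗ L` fixes every `L`-point `P` of `B ⊗ L` with `P ^ N = 1`, then `u` fixes every `k`-point `Q` of
`B` with `Q ^ N = 1`** (any field extension `L/k`). [cite: MumfordAV1970, §4] [cite: Hartshorne1977, II Ex. 2.7] -/
theorem forall_torsion_map_eq_of_baseChange (u : B ⟶ B) {N : ℕ}
    (h : ∀ P : (B.baseChange L).Points L, P ^ N = 1 → AlgPoints.map (Hom.baseChange L u).hom.hom.hom P = P) :
    ∀ Q : B.Points k, Q ^ N = 1 → AlgPoints.map u.hom.hom.hom Q = Q := by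
  obtain ⟨φ, hφinj, -, hφnat⟩ := exists_monoidHom_points_baseChange L B
  intro Q hQ
  apply hφinj
  rw [hφnat, h (φ Q) (by rw [← map_pow, hQ, map_one])]

/-! ## §3 (D5, up) Over algebraically closed fields the torsion clause ascends -/

/-- **`(B ⊗ L)[N](L) = B[N](k)` for `k ⊆ L` both algebraically closed and `N` invertible in `k`**: every `L`-point `P`
of `B ⊗ L` with `P ^ N = 1` is `Q_L` for a (unique) `k`-point `Q` of `B` with `Q ^ N = 1` — `Q ↦ Q_L` is injective and
both finite sets have `N^{2 dim B}` elements (★ `natCard_torsionPoints_eq_of_isAlgClosed`, [MumfordAV1970] §6 App. 3;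
★ `dim_baseChange`).  The ★ `exists_pointsMulEquiv_extendScalars_eq_of_mem_torsionPoints` with `ℂ` replaced by `L`.
[cite: MumfordAV1970, §6 Application 3 (Proposition p. 64)] [cite: SerreTate1968, §1 p. 493] -/
theorem exists_pointsMulEquiv_extendScalars_eq_of_pow_eq_one [IsAlgClosed k] [IsAlgClosed L] (B : AbelianVariety k)
    {N : ℕ} (hN : (N : k) ≠ 0) {P : (B.baseChange L).Points L} (hP : P ^ N = 1) :
    ∃ Q : B.Points k, Q ^ N = 1 ∧ B.pointsMulEquiv L (AlgPoints.extendScalars B.X k L Q) = P := by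
  have hNL : ((N : ℤ) : L) ≠ 0 := by
    rw [Int.cast_natCast, ← map_natCast (algebraMap k L), map_ne_zero]
    exact hN
  have hNk : ((N : ℤ) : k) ≠ 0 := by rwa [Int.cast_natCast]
  have hN0 : (N : ℤ) ≠ 0 := fun h => hN (by rw [Int.natCast_eq_zero.mp h, Nat.cast_zero])
  obtain ⟨φ, hφinj, hφ, -⟩ := exists_monoidHom_points_baseChange L B
  have hφtors : ∀ s ∈ B.torsionPoints k N, φ s ∈ (B.baseChange L).torsionPoints L N := fun s hs => by
    rw [mem_torsionPoints_iff] at hs ⊢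
    rw [← map_zpow, hs, map_one]
  let f : B.torsionPoints k N → (B.baseChange L).torsionPoints L N := fun s => ⟨φ s.1, hφtors s.1 s.2⟩
  have hf : Injective f := fun s t hst => Subtype.ext (hφinj (congrArg Subtype.val hst))
  haveI : Finite ((B.baseChange L).torsionPoints L N) := by
    apply Nat.finite_of_card_ne_zero
    rw [(B.baseChange L).natCard_torsionPoints_eq_of_isAlgClosed L N hNL]
    exact pow_ne_zero _ (Int.natAbs_ne_zero.mpr hN0)
  have hcard : Nat.card ((B.baseChange L).torsionPoints L N) ≤ Nat.card (B.torsionPoints k N) := by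
    rw [(B.baseChange L).natCard_torsionPoints_eq_of_isAlgClosed L N hNL,
      B.natCard_torsionPoints_eq_of_isAlgClosed k N hNk, dim_baseChange]
  have hPz : P ∈ (B.baseChange L).torsionPoints L N := by
    rw [mem_torsionPoints_iff, zpow_natCast, hP]
  obtain ⟨s, hs⟩ := (hf.bijective_of_nat_card_le hcard).2 ⟨P, hPz⟩
  refine ⟨s.1, ?_, (hφ s.1).symm.trans (congrArg Subtype.val hs)⟩
  have h2 := s.2
  rwa [mem_torsionPoints_iff, zpow_natCast] at h2

/-- **(D5, UP) For `k ⊆ L` algebraically closed and `(N : k) ≠ 0`: if `u` fixes every `k`-point `Q` of `B` with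
`Q ^ N = 1`, then `u ⊗ L` fixes every `L`-point `P` of `B ⊗ L` with `P ^ N = 1`.**
[cite: MumfordAV1970, §6 Application 3 (Proposition p. 64)] [cite: SerreTate1968, §1 p. 493] -/
theorem forall_torsion_map_baseChange_eq [IsAlgClosed k] [IsAlgClosed L] (u : B ⟶ B) {N : ℕ} (hN : (N : k) ≠ 0)
    (h : ∀ Q : B.Points k, Q ^ N = 1 → AlgPoints.map u.hom.hom.hom Q = Q) :
    ∀ P : (B.baseChange L).Points L, P ^ N = 1 → AlgPoints.map (Hom.baseChange L u).hom.hom.hom P = P := by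
  obtain ⟨φ, -, hφ, hφnat⟩ := exists_monoidHom_points_baseChange L B
  intro P hP
  obtain ⟨Q, hQ, rfl⟩ := exists_pointsMulEquiv_extendScalars_eq_of_pow_eq_one L B hN hP
  rw [← hφ, ← hφnat, h Q hQ]

/-- **The torsion clause is INVARIANT under base change between algebraically closed fields** (`(N : k) ≠ 0`).
[cite: MumfordAV1970, §6 Application 3 (Proposition p. 64)] -/
theorem forall_torsion_map_baseChange_eq_iff [IsAlgClosed k] [IsAlgClosed L] (u : B ⟶ B) {N : ℕ} (hN : (N : k) ≠ 0) :
    (∀ P : (B.baseChange L).Points L, P ^ N = 1 → AlgPoints.map (Hom.baseChange L u).hom.hom.hom P = P) ↔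
      ∀ Q : B.Points k, Q ^ N = 1 → AlgPoints.map u.hom.hom.hom Q = Q :=
  ⟨forall_torsion_map_eq_of_baseChange L u, forall_torsion_map_baseChange_eq L u hN⟩

/-! ## §4 Transport along a descent isomorphism `ε : B₁ ⊗ L ≅ B` -/

section Conj

variable {L} {B₁ : AbelianVariety k} {B' : AbelianVariety L}

/-- `ε⁻¹ (ε P) = P` on points. [cite: Hartshorne1977, II Ex. 2.7] -/
private theorem baseChangeIso_inv_map_hom_points (ε : B₁.baseChange L ≅ B') (P : (B₁.baseChange L).Points L) :
    AlgPoints.map ε.inv.hom.hom.hom (AlgPoints.map ε.hom.hom.hom.hom P) = P := by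
  rw [← AlgPoints.map_comp_apply]
  change AlgPoints.map (ε.hom ≫ ε.inv).hom.hom.hom P = P
  rw [ε.hom_inv_id]
  exact AlgPoints.map_id_apply P

/-- `ε (ε⁻¹ P) = P` on points. [cite: Hartshorne1977, II Ex. 2.7] -/
private theorem baseChangeIso_hom_map_inv_points (ε : B₁.baseChange L ≅ B') (P : B'.Points L) :
    AlgPoints.map ε.hom.hom.hom.hom (AlgPoints.map ε.inv.hom.hom.hom P) = P := by
  rw [← AlgPoints.map_comp_apply]
  change AlgPoints.map (ε.inv ≫ ε.hom).hom.hom.hom P = P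
  rw [ε.inv_hom_id]
  exact AlgPoints.map_id_apply P

/-- **TRANSPORT of the torsion clause along `ε : B₁ ⊗ L ≅ B`** with `(e₁ ⊗ L) ≫ ε = ε ≫ e` (the shape the descent of
an automorphism delivers): `e` fixes the `N`-torsion `L`-points of `B` iff `e₁ ⊗ L` fixes those of `B₁ ⊗ L` (points
moved by the group isomorphism `ε(L)`). [cite: Hartshorne1977, II Ex. 2.7] [cite: MumfordAV1970, §4] -/
theorem forall_torsion_map_eq_iff_of_conj (ε : B₁.baseChange L ≅ B') (e₁ : B₁ ⟶ B₁) (e : B' ⟶ B')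
    (hconj : Hom.baseChange L e₁ ≫ ε.hom = ε.hom ≫ e) {N : ℕ} :
    (∀ P : B'.Points L, P ^ N = 1 → AlgPoints.map e.hom.hom.hom P = P) ↔
      ∀ P : (B₁.baseChange L).Points L, P ^ N = 1 → AlgPoints.map (Hom.baseChange L e₁).hom.hom.hom P = P := by
  -- the group isomorphism `ε(L)` on points and its intertwining
  let fwd : (B₁.baseChange L).Points L →* B'.Points L := IsMonHom.monoidHom ε.hom.hom.hom.hom (specOver L L)
  have hfwd : ∀ P, fwd P = AlgPoints.map ε.hom.hom.hom.hom P := fun P => rfl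
  have hinter : ∀ P : (B₁.baseChange L).Points L,
      AlgPoints.map ε.hom.hom.hom.hom (AlgPoints.map (Hom.baseChange L e₁).hom.hom.hom P) =
        AlgPoints.map e.hom.hom.hom (AlgPoints.map ε.hom.hom.hom.hom P) := fun P => by
    rw [← AlgPoints.map_comp_apply, ← AlgPoints.map_comp_apply]
    change AlgPoints.map (Hom.baseChange L e₁ ≫ ε.hom).hom.hom.hom P = AlgPoints.map (ε.hom ≫ e).hom.hom.hom P
    rw [hconj]
  constructor
  · intro h P hP
    have hP' : AlgPoints.map ε.hom.hom.hom.hom P ^ N = 1 := by rw [← hfwd, ← map_pow, hP, map_one]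
    have h1 := h _ hP'
    rw [← hinter] at h1
    have h2 := congrArg (AlgPoints.map ε.inv.hom.hom.hom) h1
    rwa [baseChangeIso_inv_map_hom_points, baseChangeIso_inv_map_hom_points] at h2
  · intro h P hP
    -- `P = ε P₁` with `P₁ := ε⁻¹ P` torsion
    have hP₁ : AlgPoints.map ε.inv.hom.hom.hom P ^ N = 1 := by
      let bwd : B'.Points L →* (B₁.baseChange L).Points L := IsMonHom.monoidHom ε.inv.hom.hom.hom (specOver L L)
      change bwd P ^ N = 1
      rw [← map_pow, hP, map_one]
    have h1 := h _ hP₁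
    have h2 := congrArg (AlgPoints.map ε.hom.hom.hom.hom) h1
    rwa [hinter, baseChangeIso_hom_map_inv_points] at h2

/-- **TRANSPORT of the conclusion**: under `(e₁ ⊗ L) ≫ ε = ε ≫ e` with `ε` an isomorphism, `e₁ ⊗ L = 𝟙 ↔ e = 𝟙`.
[cite: MumfordAV1970, §4] -/
theorem baseChange_eq_id_iff_of_conj (ε : B₁.baseChange L ≅ B') (e₁ : B₁ ⟶ B₁) (e : B' ⟶ B')
    (hconj : Hom.baseChange L e₁ ≫ ε.hom = ε.hom ≫ e) : Hom.baseChange L e₁ = 𝟙 _ ↔ e = 𝟙 _ := by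
  constructor
  · intro h
    rw [h, Category.id_comp] at hconj
    rw [← cancel_epi ε.hom, ← hconj, Category.comp_id]
  · intro h
    rw [h, Category.comp_id] at hconj
    rw [← cancel_mono ε.hom, hconj, Category.id_comp]

/-- **(D6) along a descent isomorphism**: `(e₁ ⊗ L) ≫ ε = ε ≫ e` and `e = 𝟙` force `e₁ = 𝟙`. [cite: MumfordAV1970, §4] -/
theorem eq_id_of_conj_of_eq_id (ε : B₁.baseChange L ≅ B') (e₁ : B₁ ⟶ B₁) (e : B' ⟶ B')
    (hconj : Hom.baseChange L e₁ ≫ ε.hom = ε.hom ≫ e) (he : e = 𝟙 _) : e₁ = 𝟙 B₁ :=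
  eq_id_of_baseChange_eq_id L e₁ ((baseChange_eq_id_iff_of_conj ε e₁ e hconj).2 he)

end Conj

/-! ## §5 (D7) Glue: a torsion-rigidity statement over `L` yields the one over `k` -/

/-- **(D7) TRANSFER OF «FIXES THE `N`-TORSION ⇒ IDENTITY» DOWN A FIELD EXTENSION OF ALGEBRAICALLY CLOSED FIELDS**: for
`k ⊆ L` algebraically closed, `(N : k) ≠ 0` and `u : B → B` fixing every `N`-torsion `k`-point, if the rigidity statement
«`u ⊗ L` fixes the `N`-torsion `L`-points of `B ⊗ L ⇒ u ⊗ L = 𝟙`» is available (e.g. from the complex-analytic (FB′)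
brick at `L = ℂ` once the remaining hypotheses on `u ⊗ L` are discharged), then `u = 𝟙` (§3 up, then §1).
[cite: MumfordAV1970, §6 Application 3 (Proposition p. 64)] [cite: MumfordAV1970, §4] -/
theorem eq_id_of_forall_torsion_map_eq_of_baseChange [IsAlgClosed k] [IsAlgClosed L] (u : B ⟶ B) {N : ℕ}
    (hN : (N : k) ≠ 0) (htors : ∀ Q : B.Points k, Q ^ N = 1 → AlgPoints.map u.hom.hom.hom Q = Q)
    (hL : (∀ P : (B.baseChange L).Points L, P ^ N = 1 → AlgPoints.map (Hom.baseChange L u).hom.hom.hom P = P) →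
      Hom.baseChange L u = 𝟙 (B.baseChange L)) :
    u = 𝟙 B :=
  eq_id_of_baseChange_eq_id L u (hL (forall_torsion_map_baseChange_eq L u hN htors))

end Literature.AlgebraicGeometry.Motives.AbelianVariety

end
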